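import Mathlib.MeasureTheory.Function.LpSeminorm.Monotonicity
import Mathlib.MeasureTheory.Integral.Bochner.ContinuousLinearMap
import Mathlib.Topology.Algebra.Module.FiniteDimension
import Literature.Analysis.Fourier.LpMultiplier
import HarnessLib

/-!
# `Lᵖ` Fourier multipliers: constant matrix factors

Constant matrices are `Lᵖ` multipliers for every `p`, and `M_p` is closed under products with
them: if `M ∈ M_p` then `S M ∈ M_p` and `M S ∈ M_p` for constant matrices `S` (of the right
shapes), with the constants of the sup norms. This is the special case of the algebra property
`M_p(ab) ≤ M_p(a)M_p(b)` [BrennerThomeeWahlbin1975, Ch. 1 Thm 2.7; Ch. 5 (1.3)] in which one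
factor is constant — all that is needed to pass between similar symbols
`M` and `S M S⁻¹` (a constant change of the dependent variables, e.g. the unitary
diagonalisation `ũ = Uu` in [BrennerThomeeWahlbin1975, Ch. 5 §1, proof of Thm 1.1], or a
symmetrizer).

## Contents

* `fourier_mulVec`, `fourierInv_mulVec` — a constant matrix passes through `𝓕`, `𝓕⁻`
  (integrable integrands);
* `multiplierOp_const_mul`, `multiplierOp_mul_const` — `(SM)(D)f = S·M(D)f`,
  `(MS)(D)f = M(D)(Sf)`;
* `IsLpMultiplierWith.const_mul`, `IsLpMultiplierWith.mul_const`, `IsLpMultiplier.const_mul`,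
  `IsLpMultiplier.mul_const`, `IsLpMultiplier.conj`.

## References

* [BrennerThomeeWahlbin1975] P. Brenner, V. Thomée, L. B. Wahlbin, LNM 434 (1975), Ch. 1
  Thm 2.7; Ch. 5 §1 (1.3) p. 91 and proof of Thm 1.1.
-/

noncomputable section

open MeasureTheory FourierTransform
open scoped SchwartzMap ENNReal NNReal

namespace Literature.Analysis.Fourier

variable {V : Type*} [NormedAddCommGroup V] [InnerProductSpace ℝ V] [FiniteDimensional ℝ V]
  [MeasurableSpace V] [BorelSpace V] {ι κ κ' : Type*} [Fintype ι] [Fintype κ] [Fintype κ']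

/-! ### Constant matrices commute with `𝓕`, `𝓕⁻` -/

/-- A constant matrix passes through the Fourier integral of an integrable function.
[folklore] -/
theorem fourier_mulVec (S : Matrix κ' κ ℂ) {g : V → κ → ℂ} (hg : Integrable g) :
    𝓕 (fun x => S.mulVec (g x)) = fun ξ => S.mulVec (𝓕 g ξ) := by
  funext ξ
  set L : (κ → ℂ) →L[ℂ] (κ' → ℂ) := LinearMap.toContinuousLinearMap (Matrix.mulVecLin S)
  have hL : ∀ v, L v = S.mulVec v := fun v => rfl
  rw [Real.fourier_eq, Real.fourier_eq, ← hL, ← ContinuousLinearMap.integral_comp_comm L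
    ((Real.fourierIntegral_convergent_iff ξ).2 hg)]
  refine integral_congr_ae (Filter.Eventually.of_forall fun v => ?_)
  simp only [hL, Circle.smul_def, Matrix.mulVec_smul]

/-- A constant matrix passes through the inverse Fourier integral of an integrable function.
[folklore] -/
theorem fourierInv_mulVec (S : Matrix κ' κ ℂ) {g : V → κ → ℂ} (hg : Integrable g) :
    𝓕⁻ (fun x => S.mulVec (g x)) = fun ξ => S.mulVec (𝓕⁻ g ξ) := by
  funext ξ
  set L : (κ → ℂ) →L[ℂ] (κ' → ℂ) := LinearMap.toContinuousLinearMap (Matrix.mulVecLin S)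
  have hL : ∀ v, L v = S.mulVec v := fun v => rfl
  have hint : Integrable (fun v : V => (𝐞 (inner ℝ v ξ) : Circle) • g v) := by
    have := (Real.fourierIntegral_convergent_iff (-ξ)).2 hg
    simpa [inner_neg_right] using this
  rw [Real.fourierInv_eq, Real.fourierInv_eq, ← hL, ← ContinuousLinearMap.integral_comp_comm L
    hint]
  refine integral_congr_ae (Filter.Eventually.of_forall fun v => ?_)
  simp only [hL, Circle.smul_def, Matrix.mulVec_smul]

/-! ### Constant factors in `multiplierOp` -/

/-- `(S M)(D) f = S · M(D) f` when `M · 𝓕f` is integrable. [folklore] -/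
theorem multiplierOp_const_mul (S : Matrix κ' κ ℂ) (M : V → Matrix κ ι ℂ) {f : V → ι → ℂ}
    (hint : Integrable (fun ξ => (M ξ).mulVec (𝓕 f ξ))) :
    multiplierOp (fun ξ => S * M ξ) f = fun x => S.mulVec (multiplierOp M f x) := by
  simp only [multiplierOp_apply, ← Matrix.mulVec_mulVec]
  exact fourierInv_mulVec S hint

/-- `(M S)(D) f = M(D) (S f)` for integrable `f`. [folklore] -/
theorem multiplierOp_mul_const (M : V → Matrix κ ι ℂ) (S : Matrix ι κ' ℂ) {f : V → κ' → ℂ}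
    (hf : Integrable f) :
    multiplierOp (fun ξ => M ξ * S) f = multiplierOp M (fun x => S.mulVec (f x)) := by
  simp only [multiplierOp_apply, ← Matrix.mulVec_mulVec, fourier_mulVec S hf]

/-- Pointwise bound for a constant matrix in the sup norms: `‖S v‖ ≤ ‖S‖_op ‖v‖`, phrased with
the operator norm of `v ↦ S v`. [folklore] -/
theorem nnnorm_mulVec_le (S : Matrix κ' κ ℂ) (v : κ → ℂ) :
    ‖S.mulVec v‖₊ ≤ ‖LinearMap.toContinuousLinearMap (Matrix.mulVecLin S)‖₊ * ‖v‖₊ :=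
  (LinearMap.toContinuousLinearMap (Matrix.mulVecLin S)).le_opNNNorm v

/-- `‖S g‖_{Lᵖ} ≤ ‖S‖_op ‖g‖_{Lᵖ}` for a constant matrix `S`. [folklore] -/
theorem eLpNorm_mulVec_le (S : Matrix κ' κ ℂ) (g : V → κ → ℂ) (p : ℝ≥0∞) :
    eLpNorm (fun x => S.mulVec (g x)) p volume ≤
      ‖LinearMap.toContinuousLinearMap (Matrix.mulVecLin S)‖₊ * eLpNorm g p volume := by
  have := eLpNorm_le_nnreal_smul_eLpNorm_of_ae_le_mul
    (Filter.Eventually.of_forall fun x => nnnorm_mulVec_le S (g x)) p (μ := volume)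
  simpa [ENNReal.smul_def, smul_eq_mul] using this

/-! ### `M_p` is closed under constant factors -/

namespace IsLpMultiplierWith

variable {p : ℝ≥0∞} {C : ℝ≥0} {M : V → Matrix κ ι ℂ}

/-- Left constant factor: `M ∈ M_p ⟹ S M ∈ M_p`, constant `‖S‖_op C`.
[cite: BrennerThomeeWahlbin1975, Ch. 5 §1 (1.3)] -/
theorem const_mul (h : IsLpMultiplierWith p C M) (S : Matrix κ' κ ℂ) :
    IsLpMultiplierWith p (‖LinearMap.toContinuousLinearMap (Matrix.mulVecLin S)‖₊ * C)
      (fun ξ => S * M ξ) := by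
  refine ⟨fun f => ?_, fun f => ?_⟩
  · have := (LinearMap.toContinuousLinearMap (Matrix.mulVecLin S)).integrable_comp
      (h.integrable f)
    simpa [← Matrix.mulVec_mulVec] using this
  · rw [multiplierOp_const_mul S M (h.integrable f), ENNReal.coe_mul, mul_assoc]
    exact (eLpNorm_mulVec_le S _ p).trans (mul_le_mul_right (h.bound f) _)

/-- Right constant factor: `M ∈ M_p ⟹ M S ∈ M_p`, constant `C ‖S‖_op` (test functions `f` are
replaced by the Schwartz functions `S f`, `SchwartzMap.postcompCLM`).
[cite: BrennerThomeeWahlbin1975, Ch. 5 §1 (1.3)] -/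
theorem mul_const (h : IsLpMultiplierWith p C M) (S : Matrix ι κ' ℂ) :
    IsLpMultiplierWith p (C * ‖LinearMap.toContinuousLinearMap (Matrix.mulVecLin S)‖₊)
      (fun ξ => M ξ * S) := by
  set L : (κ' → ℂ) →L[ℂ] (ι → ℂ) := LinearMap.toContinuousLinearMap (Matrix.mulVecLin S) with hLdef
  have hL : ∀ v, L v = S.mulVec v := fun v => rfl
  have hSf : ∀ f : 𝓢(V, κ' → ℂ), (fun x => S.mulVec (f x)) = ⇑(SchwartzMap.postcompCLM L f) :=
    fun f => by funext x; rw [SchwartzMap.postcompCLM_apply, hL]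
  refine ⟨fun f => ?_, fun f => ?_⟩
  · have hg := h.integrable (SchwartzMap.postcompCLM L f)
    rw [← hSf, fourier_mulVec S f.integrable] at hg
    simpa [← Matrix.mulVec_mulVec] using hg
  · rw [multiplierOp_mul_const M S f.integrable, hSf, ENNReal.coe_mul, mul_assoc]
    refine (h.bound _).trans (mul_le_mul_right ?_ _)
    rw [← hSf]
    exact eLpNorm_mulVec_le S _ p

end IsLpMultiplierWith

namespace IsLpMultiplier

variable {p : ℝ≥0∞} {M : V → Matrix κ ι ℂ}

/-- `M ∈ M_p ⟹ S M ∈ M_p` for a constant matrix `S`. [cite: BrennerThomeeWahlbin1975, Ch. 5 §1 (1.3)] -/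
theorem const_mul (h : IsLpMultiplier p M) (S : Matrix κ' κ ℂ) :
    IsLpMultiplier p (fun ξ => S * M ξ) := by
  obtain ⟨C, hC⟩ := h
  exact (hC.const_mul S).isLpMultiplier

/-- `M ∈ M_p ⟹ M S ∈ M_p` for a constant matrix `S`. [cite: BrennerThomeeWahlbin1975, Ch. 5 §1 (1.3)] -/
theorem mul_const (h : IsLpMultiplier p M) (S : Matrix ι κ' ℂ) :
    IsLpMultiplier p (fun ξ => M ξ * S) := by
  obtain ⟨C, hC⟩ := h
  exact (hC.mul_const S).isLpMultiplier

/-- **Similar symbols**: `M ∈ M_p ⟹ S M S' ∈ M_p` for constant matrices `S, S'` (e.g.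
`S' = S⁻¹`: a constant linear change of the dependent variables).
[cite: BrennerThomeeWahlbin1975, Ch. 5 §1 (1.3) and proof of Thm 1.1] -/
theorem conj (h : IsLpMultiplier p M) (S : Matrix κ' κ ℂ) (S' : Matrix ι ι ℂ) :
    IsLpMultiplier p (fun ξ => S * M ξ * S') :=
  (h.const_mul S).mul_const S'

end IsLpMultiplier

end Literature.Analysis.Fourier

end
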